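import Summits.CriticalPhenomena.PercolationContinuityZ3.Theorems.PercNearOneGluingNoHeavyQuantIndepBlobCloudClamp
import HarnessLib

/-!
# QUANT lane R8, Conjecture DIB\* for TWO-BIN MEDIUM CLOUDS: any number of light blobs, each bigger than half the shortfall, that can
# be packed into two bins of size `≤ Cp/x` each (`Cp = 2j − C_H`), every floor `0 < x < 1`

builds on p205010 (kernel theorem, internal audit signed; external expert review pending)

Support file (`--supports stmt-CriticalPhenomena-4575`), QUANT lane census seat prim-quant-census-1 (gen 15), rung R8 of
`run/shared/lean/prim/quant/LADDER.md`; memo `run/shared/lean/prim/quant/prim-quant-census-1/SMALL-CLOUD-G15.md` §11–§12.  Part (VI) of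
the cloud series (`…CloudComponents`, `…SmallCloud`, `…BigLights`, `…CloudClamp`, `…TwoMediumLights`).  Theorems only, no definitions,
no sorries, standard axioms.

THE ARGUMENT (memo §12: the MERGING step of the overshoot lemma, done pointwise).  Cloud `L = P₁ ⊔ P₂` with bin sizes `B_i = a(P_i)`,
`x·B_i ≤ Cp`; for an outcome `S` write `y_i = a(S ∩ P_i) ∈ [0, B_i]`.  Pointwise BILINEAR CHORD bound
`min(x·a(S), Cp) ≥ x·a(S) − y₁y₂·(x·M − Cp)/(B₁B₂)` — the identity
`y₁y₂(xM − Cp) − (x(y₁+y₂) − Cp)B₁B₂ = B₁(B₂ − y₂)(Cp − x y₁) + y₂(B₁ − y₁)(Cp − x B₂) ≥ 0` — and the CROSS MOMENT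
`E[y₁y₂] = (Σ_{P₁} a p)(Σ_{P₂} a p) ≤ x²B₁B₂` (independence of the bins, gates `≤ x`) give the truncated-mean condition
`E[min(xΛ, Cp)] − x·Cp ≥ x(1−x)(C_L − Cp) > 0`, i.e. the clamp certificate of `tail_ge_of_clampCert`.  This is the overshoot lemma
(OS) of the memo for every cloud that MERGES into two admissible blobs; with one light per bin it is `…TwoMediumLights`.

* `Quant.IndepBlob.sum_powerset_weight_mem`, `sum_powerset_weight_pair`, `sum_powerset_weight_cross` — first and cross moments of
  the restricted product weights (`E[𝟙(i ∈ S)] = p_i`, `E[𝟙(i ∈ S)𝟙(k ∈ S)] = p_i p_k`, `E[y₁ y₂] = m₁ m₂`).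
* `Quant.IndepBlob.tail_ge_of_twoBins` — **floor `0 < x < 1`; cloud `L = P₁ ⊔ P₂` with gates `< x`, every other blob heavy; every light
  `2·a_k > Cp`; bins `x·a(P_i) ≤ Cp`; credit `2j < C_H + Σ_L a_k·κ_x(p_k)` ⟹ `x ≤ P(N ≥ j+1)`.**
* `Quant.IndepBlob.dibStar_of_twoBins` — DIB\*'s binder shape: the lights (`g < x`) split by a finset `P` into two bins of size `≤ Cp/x`,
  each light of size `> Cp/2`, DIB\* credit ⟹ row.  Census (memo §12): the two-bin condition holds for 52 % of the 'all lights medium'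
  corner instances (which are 29 % of the sampled corner at the hardest budget).

[this work; this lane's census]; the gluing rows served: [cite: KozmaNitzan2024, Conjecture 3 (p. 15)]; product weights
[cite: Grimmett1999, §1.3 p. 10].
-/

namespace Summit.CriticalPhenomena.PercolationContinuityZ3.Theorems

namespace Quant

namespace IndepBlob

open Finset

variable {κ : Type*} [DecidableEq κ]

/-! ### 10. First and cross moments of the restricted weights -/

/-- `E[𝟙(i ∈ S)] = p_i` under the restricted weights of `L ∋ i`. [folklore] -/
theorem sum_powerset_weight_mem (p : κ → ℝ) (L : Finset κ) (i : κ) (hi : i ∈ L) :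
    ∑ S ∈ L.powerset, (∏ k ∈ L, if k ∈ S then p k else 1 - p k) * (if i ∈ S then (1 : ℝ) else 0) = p i := by
  have hL : L = insert i (L.erase i) := (Finset.insert_erase hi).symm
  rw [hL, sum_powerset_weight_insert p (L.erase i) i (Finset.notMem_erase i L) (fun S => if i ∈ S then (1 : ℝ) else 0)]
  have h1 : ∑ S ∈ (L.erase i).powerset, (∏ k ∈ L.erase i, if k ∈ S then p k else 1 - p k) *
      (if i ∈ insert i S then (1 : ℝ) else 0) = 1 := by
    rw [Finset.sum_congr rfl (fun S _ => by rw [if_pos (Finset.mem_insert_self i S), mul_one]), sum_powerset_weight]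
  have h0 : ∑ S ∈ (L.erase i).powerset, (∏ k ∈ L.erase i, if k ∈ S then p k else 1 - p k) *
      (if i ∈ S then (1 : ℝ) else 0) = 0 :=
    Finset.sum_eq_zero fun S hS => by
      rw [if_neg (fun h => Finset.notMem_erase i L (Finset.mem_powerset.1 hS h)), mul_zero]
  rw [h1, h0, mul_one, mul_zero, add_zero]

/-- `E[𝟙(i ∈ S)·𝟙(k ∈ S)] = p_i·p_k` for distinct `i, k ∈ L`. [folklore] -/
theorem sum_powerset_weight_pair (p : κ → ℝ) (L : Finset κ) (i k : κ) (hi : i ∈ L) (hk : k ∈ L) (hik : i ≠ k) :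
    ∑ S ∈ L.powerset, (∏ l ∈ L, if l ∈ S then p l else 1 - p l) *
      ((if i ∈ S then (1 : ℝ) else 0) * (if k ∈ S then (1 : ℝ) else 0)) = p i * p k := by
  have hL : L = insert i (L.erase i) := (Finset.insert_erase hi).symm
  have hk' : k ∈ L.erase i := Finset.mem_erase.2 ⟨hik.symm, hk⟩
  rw [hL, sum_powerset_weight_insert p (L.erase i) i (Finset.notMem_erase i L)
    (fun S => (if i ∈ S then (1 : ℝ) else 0) * (if k ∈ S then (1 : ℝ) else 0))]
  have h1 : ∑ S ∈ (L.erase i).powerset, (∏ l ∈ L.erase i, if l ∈ S then p l else 1 - p l) *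
      ((if i ∈ insert i S then (1 : ℝ) else 0) * (if k ∈ insert i S then (1 : ℝ) else 0)) = p k := by
    rw [← sum_powerset_weight_mem p (L.erase i) k hk']
    refine Finset.sum_congr rfl fun S _ => ?_
    rw [if_pos (Finset.mem_insert_self i S), one_mul]
    congr 1
    simp only [Finset.mem_insert, hik.symm, false_or]
  have h0 : ∑ S ∈ (L.erase i).powerset, (∏ l ∈ L.erase i, if l ∈ S then p l else 1 - p l) *
      ((if i ∈ S then (1 : ℝ) else 0) * (if k ∈ S then (1 : ℝ) else 0)) = 0 :=
    Finset.sum_eq_zero fun S hS => by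
      rw [if_neg (fun h => Finset.notMem_erase i L (Finset.mem_powerset.1 hS h)), zero_mul, mul_zero]
  rw [h1, h0, mul_zero, add_zero]

/-- **Cross moment of two disjoint bins**: `E[a(S ∩ P₁)·a(S ∩ P₂)] = (Σ_{P₁} a p)(Σ_{P₂} a p)` under the restricted weights of
`L ⊇ P₁, P₂`. [folklore] -/
theorem sum_powerset_weight_cross (p : κ → ℝ) (a : κ → ℕ) (L P₁ P₂ : Finset κ) (h₁ : P₁ ⊆ L) (h₂ : P₂ ⊆ L)
    (hd : Disjoint P₁ P₂) :
    ∑ S ∈ L.powerset, (∏ l ∈ L, if l ∈ S then p l else 1 - p l) *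
      ((∑ i ∈ P₁, if i ∈ S then (a i : ℝ) else 0) * (∑ k ∈ P₂, if k ∈ S then (a k : ℝ) else 0)) =
      (∑ i ∈ P₁, (a i : ℝ) * p i) * (∑ k ∈ P₂, (a k : ℝ) * p k) := by
  -- expand the product of the two bin sums and swap with the outcome sum
  have hexp : ∀ S : Finset κ, (∑ i ∈ P₁, if i ∈ S then (a i : ℝ) else 0) * (∑ k ∈ P₂, if k ∈ S then (a k : ℝ) else 0) =
      ∑ i ∈ P₁, ∑ k ∈ P₂, (a i : ℝ) * (a k : ℝ) * ((if i ∈ S then (1 : ℝ) else 0) * (if k ∈ S then (1 : ℝ) else 0)) := by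
    intro S
    rw [Finset.sum_mul_sum]
    refine Finset.sum_congr rfl fun i _ => Finset.sum_congr rfl fun k _ => ?_
    split_ifs <;> simp
  calc ∑ S ∈ L.powerset, (∏ l ∈ L, if l ∈ S then p l else 1 - p l) *
        ((∑ i ∈ P₁, if i ∈ S then (a i : ℝ) else 0) * (∑ k ∈ P₂, if k ∈ S then (a k : ℝ) else 0))
      = ∑ S ∈ L.powerset, ∑ i ∈ P₁, ∑ k ∈ P₂, (a i : ℝ) * (a k : ℝ) *
          ((∏ l ∈ L, if l ∈ S then p l else 1 - p l) * ((if i ∈ S then (1 : ℝ) else 0) * (if k ∈ S then (1 : ℝ) else 0))) := by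
        refine Finset.sum_congr rfl fun S _ => ?_
        rw [hexp S, Finset.mul_sum]
        refine Finset.sum_congr rfl fun i _ => ?_
        rw [Finset.mul_sum]
        exact Finset.sum_congr rfl fun k _ => by ring
    _ = ∑ i ∈ P₁, ∑ k ∈ P₂, ∑ S ∈ L.powerset, (a i : ℝ) * (a k : ℝ) *
          ((∏ l ∈ L, if l ∈ S then p l else 1 - p l) * ((if i ∈ S then (1 : ℝ) else 0) * (if k ∈ S then (1 : ℝ) else 0))) := by
        rw [Finset.sum_comm]
        exact Finset.sum_congr rfl fun i _ => Finset.sum_comm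
    _ = ∑ i ∈ P₁, ∑ k ∈ P₂, (a i : ℝ) * (a k : ℝ) * (p i * p k) := by
        refine Finset.sum_congr rfl fun i hi => Finset.sum_congr rfl fun k hk => ?_
        rw [← Finset.mul_sum, sum_powerset_weight_pair p L i k (h₁ hi) (h₂ hk)
          (fun h => Finset.disjoint_left.1 hd hi (h ▸ hk))]
    _ = (∑ i ∈ P₁, (a i : ℝ) * p i) * (∑ k ∈ P₂, (a k : ℝ) * p k) := by
        rw [Finset.sum_mul_sum]
        exact Finset.sum_congr rfl fun i _ => Finset.sum_congr rfl fun k _ => by ring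

/-! ### 11. Two-bin medium clouds -/

/-- **DIB\* FOR TWO-BIN MEDIUM CLOUDS.**  See the module docstring. [this work] -/
theorem tail_ge_of_twoBins [Fintype κ] (p : κ → ℝ) (a : κ → ℕ) (x : ℝ) (hx0 : 0 < x) (hx1 : x < 1)
    (hp0 : ∀ k, 0 ≤ p k) (hp1 : ∀ k, p k ≤ 1) (L : Finset κ) (hheavy : ∀ k, k ∉ L → x ≤ p k)
    (hlight : ∀ k ∈ L, p k < x) (j : ℕ)
    (hmid : ∀ k ∈ L, (2 * j : ℝ) < (∑ i ∈ Finset.univ \ L, (a i : ℝ) * p i) + 2 * (a k : ℝ))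
    (P₁ P₂ : Finset κ) (hP : P₁ ∪ P₂ = L) (hdisj : Disjoint P₁ P₂)
    (hbin₁ : (∑ i ∈ Finset.univ \ L, (a i : ℝ) * p i) + x * (∑ k ∈ P₁, (a k : ℝ)) ≤ 2 * j)
    (hbin₂ : (∑ i ∈ Finset.univ \ L, (a i : ℝ) * p i) + x * (∑ k ∈ P₂, (a k : ℝ)) ≤ 2 * j)
    (hcredit : (2 * j : ℝ) < (∑ i ∈ Finset.univ \ L, (a i : ℝ) * p i) + ∑ k ∈ L, (a k : ℝ) * ((p k - x ^ 2) / (1 - x))) :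
    x ≤ ∑ s : Finset κ, (∏ k, if k ∈ s then p k else 1 - p k) * (if j + 1 ≤ ∑ k ∈ s, a k then (1 : ℝ) else 0) := by
  have h1x : 0 < 1 - x := by linarith
  set CH : ℝ := ∑ i ∈ Finset.univ \ L, (a i : ℝ) * p i with hCH
  set Cp : ℝ := 2 * j - CH with hCp
  set wL : Finset κ → ℝ := fun S => ∏ k ∈ L, if k ∈ S then p k else 1 - p k with hwL
  set B₁ : ℝ := ∑ k ∈ P₁, (a k : ℝ) with hB₁
  set B₂ : ℝ := ∑ k ∈ P₂, (a k : ℝ) with hB₂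
  set m₁ : ℝ := ∑ k ∈ P₁, (a k : ℝ) * p k with hm₁
  set m₂ : ℝ := ∑ k ∈ P₂, (a k : ℝ) * p k with hm₂
  set y₁ : Finset κ → ℝ := fun S => ∑ i ∈ P₁, if i ∈ S then (a i : ℝ) else 0 with hy₁
  set y₂ : Finset κ → ℝ := fun S => ∑ i ∈ P₂, if i ∈ S then (a i : ℝ) else 0 with hy₂
  have hP₁L : P₁ ⊆ L := by rw [← hP]; exact Finset.subset_union_left
  have hP₂L : P₂ ⊆ L := by rw [← hP]; exact Finset.subset_union_right
  have hwL0 : ∀ S, 0 ≤ wL S := fun S => weightU_nonneg p L (fun k _ => hp0 k) (fun k _ => hp1 k) S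
  -- sizes and means of the bins
  have hB1nn : 0 ≤ B₁ := Finset.sum_nonneg fun k _ => Nat.cast_nonneg _
  have hB2nn : 0 ≤ B₂ := Finset.sum_nonneg fun k _ => Nat.cast_nonneg _
  have hm1nn : 0 ≤ m₁ := Finset.sum_nonneg fun k _ => mul_nonneg (Nat.cast_nonneg _) (hp0 k)
  have hm2nn : 0 ≤ m₂ := Finset.sum_nonneg fun k _ => mul_nonneg (Nat.cast_nonneg _) (hp0 k)
  have hm1le : m₁ ≤ x * B₁ := by
    rw [hm₁, hB₁, Finset.mul_sum]
    exact Finset.sum_le_sum fun k hk => by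
      have := hlight k (hP₁L hk); nlinarith [(Nat.cast_nonneg (a k) : (0 : ℝ) ≤ (a k : ℝ))]
  have hm2le : m₂ ≤ x * B₂ := by
    rw [hm₂, hB₂, Finset.mul_sum]
    exact Finset.sum_le_sum fun k hk => by
      have := hlight k (hP₂L hk); nlinarith [(Nat.cast_nonneg (a k) : (0 : ℝ) ≤ (a k : ℝ))]
  have hsumL : ∀ f : κ → ℝ, ∑ k ∈ L, f k = ∑ k ∈ P₁, f k + ∑ k ∈ P₂, f k := fun f => by
    rw [← hP, Finset.sum_union hdisj]
  -- the credit: `(1 − x)·Cp < (m₁ + m₂) − x²(B₁ + B₂)`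
  have hCL : (1 - x) * Cp < (m₁ + m₂) - x ^ 2 * (B₁ + B₂) := by
    have e : ∑ k ∈ L, (a k : ℝ) * ((p k - x ^ 2) / (1 - x)) = ((m₁ + m₂) - x ^ 2 * (B₁ + B₂)) / (1 - x) := by
      have e1 : ∀ k ∈ L, (a k : ℝ) * ((p k - x ^ 2) / (1 - x)) = ((a k : ℝ) * p k - x ^ 2 * (a k : ℝ)) / (1 - x) := by
        intro k _; ring
      rw [Finset.sum_congr rfl e1, ← Finset.sum_div, Finset.sum_sub_distrib, ← Finset.mul_sum, hsumL, hsumL (fun k => (a k : ℝ))]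
    rw [e] at hcredit
    have h := (lt_div_iff₀ h1x).1 (by rw [hCp]; linarith : Cp < ((m₁ + m₂) - x ^ 2 * (B₁ + B₂)) / (1 - x))
    linarith
  have hxB₁ : x * B₁ ≤ Cp := by rw [hCp]; linarith
  have hxB₂ : x * B₂ ≤ Cp := by rw [hCp]; linarith
  -- both bins are non-empty (positive size), and `Cp < x M`
  have hCpM : Cp < x * (B₁ + B₂) := by nlinarith [sq_nonneg x, hm1le, hm2le, hCL]
  have hB1pos : 0 < B₁ := by
    by_contra h
    have hB0 : B₁ = 0 := le_antisymm (not_lt.1 h) hB1nn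
    rw [hB0, zero_add] at hCpM; linarith
  have hB2pos : 0 < B₂ := by
    by_contra h
    have hB0 : B₂ = 0 := le_antisymm (not_lt.1 h) hB2nn
    rw [hB0, add_zero] at hCpM; linarith
  have hCp0 : 0 < Cp := lt_of_lt_of_le (mul_pos hx0 hB1pos) hxB₁
  -- apply the clamp certificate
  refine tail_ge_of_clampCert p a x hx0 hx1 hp0 hp1 L hheavy j hmid ?_
  change x * Cp * ∏ k ∈ L, (1 - p k) <
    ∑ S ∈ L.powerset, wL S * max 0 (min (x * ((∑ k ∈ S, a k : ℕ) - Cp)) ((1 - x) * Cp))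
  -- pointwise: clamp term ≥ x a(S) − x Cp − K y₁ y₂ + [S = ∅] x Cp
  set K : ℝ := (x * (B₁ + B₂) - Cp) / (B₁ * B₂) with hK
  have hK0 : 0 ≤ K := div_nonneg (by linarith) (mul_pos hB1pos hB2pos).le
  have hKB : K * (B₁ * B₂) = x * (B₁ + B₂) - Cp := by
    rw [hK]; exact div_mul_cancel₀ _ (mul_pos hB1pos hB2pos).ne'
  have hpt : ∀ S ∈ L.powerset,
      wL S * (x * ((∑ k ∈ S, a k : ℕ) : ℝ) - x * Cp - K * (y₁ S * y₂ S)) + (if S = ∅ then wL S * (x * Cp) else 0) ≤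
        wL S * max 0 (min (x * ((∑ k ∈ S, a k : ℕ) - Cp)) ((1 - x) * Cp)) := by
    intro S hS
    have hSL : S ⊆ L := Finset.mem_powerset.1 hS
    -- `a(S) = y₁ + y₂`, `0 ≤ y_i ≤ B_i`
    have hy1e : y₁ S = ∑ i ∈ P₁ ∩ S, (a i : ℝ) := Finset.sum_ite_mem P₁ S _
    have hy2e : y₂ S = ∑ i ∈ P₂ ∩ S, (a i : ℝ) := Finset.sum_ite_mem P₂ S _
    have haS : ((∑ k ∈ S, a k : ℕ) : ℝ) = y₁ S + y₂ S := by
      rw [hy1e, hy2e, ← Finset.sum_union (Finset.disjoint_of_subset_left Finset.inter_subset_left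
        (Finset.disjoint_of_subset_right Finset.inter_subset_left hdisj)), Nat.cast_sum]
      refine Finset.sum_congr ?_ fun _ _ => rfl
      ext k
      simp only [Finset.mem_union, Finset.mem_inter]
      constructor
      · intro hk
        have hkL := hSL hk
        rw [← hP, Finset.mem_union] at hkL
        rcases hkL with h | h
        · exact Or.inl ⟨h, hk⟩
        · exact Or.inr ⟨h, hk⟩
      · rintro (⟨-, hk⟩ | ⟨-, hk⟩) <;> exact hk
    have hy1nn : 0 ≤ y₁ S := by rw [hy1e]; exact Finset.sum_nonneg fun i _ => Nat.cast_nonneg _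
    have hy2nn : 0 ≤ y₂ S := by rw [hy2e]; exact Finset.sum_nonneg fun i _ => Nat.cast_nonneg _
    have hy1le : y₁ S ≤ B₁ := by
      rw [hy1e, hB₁]; exact Finset.sum_le_sum_of_subset_of_nonneg Finset.inter_subset_left fun i _ _ => Nat.cast_nonneg _
    have hy2le : y₂ S ≤ B₂ := by
      rw [hy2e, hB₂]; exact Finset.sum_le_sum_of_subset_of_nonneg Finset.inter_subset_left fun i _ _ => Nat.cast_nonneg _
    by_cases hS0 : S = ∅
    · subst hS0
      have hy10 : y₁ ∅ = 0 := by rw [hy1e, Finset.inter_empty, Finset.sum_empty]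
      have hy20 : y₂ ∅ = 0 := by rw [hy2e, Finset.inter_empty, Finset.sum_empty]
      rw [if_pos rfl, hy10, hy20, Finset.sum_empty, Nat.cast_zero]
      have : (0 : ℝ) ≤ max 0 (min (x * (0 - Cp)) ((1 - x) * Cp)) := le_max_left _ _
      nlinarith [hwL0 ∅]
    rw [if_neg hS0, add_zero]
    refine mul_le_mul_of_nonneg_left ?_ (hwL0 S)
    -- the bilinear chord bound: `x a − K y₁y₂ ≤ min(x a, Cp)`, then `min(x a, Cp) − x Cp ≤ max 0 (…)`
    have hchord : x * (y₁ S + y₂ S) - K * (y₁ S * y₂ S) ≤ Cp := by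
      -- multiply by `B₁ B₂ > 0` and use the identity
      have hBB : 0 < B₁ * B₂ := mul_pos hB1pos hB2pos
      rw [← sub_nonneg]
      have e : (Cp - (x * (y₁ S + y₂ S) - K * (y₁ S * y₂ S))) * (B₁ * B₂) =
          B₁ * (B₂ - y₂ S) * (Cp - x * y₁ S) + y₂ S * (B₁ - y₁ S) * (Cp - x * B₂) := by
        have : K * (y₁ S * y₂ S) * (B₁ * B₂) = (y₁ S * y₂ S) * (x * (B₁ + B₂) - Cp) := by
          rw [← hKB]; ring
        linear_combination this
      have hxy1 : x * y₁ S ≤ x * B₁ := mul_le_mul_of_nonneg_left hy1le hx0.le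
      have hrhs : 0 ≤ B₁ * (B₂ - y₂ S) * (Cp - x * y₁ S) + y₂ S * (B₁ - y₁ S) * (Cp - x * B₂) :=
        add_nonneg (mul_nonneg (mul_nonneg hB1nn (by linarith)) (by linarith))
          (mul_nonneg (mul_nonneg hy2nn (by linarith)) (by linarith))
      rw [← e] at hrhs
      exact nonneg_of_mul_nonneg_left hrhs hBB
    have hmin : x * (y₁ S + y₂ S) - K * (y₁ S * y₂ S) ≤ min (x * (y₁ S + y₂ S)) Cp :=
      le_min (by linarith [mul_nonneg hK0 (mul_nonneg hy1nn hy2nn)]) hchord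
    rw [haS]
    have e2 : max 0 (min (x * (y₁ S + y₂ S - Cp)) ((1 - x) * Cp)) = max 0 (min (x * (y₁ S + y₂ S)) Cp - x * Cp) := by
      congr 1
      rw [← min_sub_sub_right]
      congr 1 <;> ring
    rw [e2]
    have h3 : min (x * (y₁ S + y₂ S)) Cp - x * Cp ≤ max 0 (min (x * (y₁ S + y₂ S)) Cp - x * Cp) := le_max_right _ _
    linarith
  -- sum the pointwise bound
  have hsum := Finset.sum_le_sum hpt
  rw [Finset.sum_add_distrib, Finset.sum_ite_eq' L.powerset (∅ : Finset κ), if_pos (Finset.empty_mem_powerset L)] at hsum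
  have e1 : ∑ S ∈ L.powerset, wL S * (x * ((∑ k ∈ S, a k : ℕ) : ℝ) - x * Cp - K * (y₁ S * y₂ S)) =
      x * (m₁ + m₂) - x * Cp - K * (m₁ * m₂) := by
    have hA : ∑ S ∈ L.powerset, wL S * ((∑ k ∈ S, a k : ℕ) : ℝ) = m₁ + m₂ := by
      rw [← hsumL (fun k => (a k : ℝ) * p k)]
      exact sum_powerset_weight_mul_mass p a L
    have hC : ∑ S ∈ L.powerset, wL S * (y₁ S * y₂ S) = m₁ * m₂ := sum_powerset_weight_cross p a L P₁ P₂ hP₁L hP₂L hdisj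
    have hW : ∑ S ∈ L.powerset, wL S = 1 := sum_powerset_weight p L
    have e : ∀ S ∈ L.powerset, wL S * (x * ((∑ k ∈ S, a k : ℕ) : ℝ) - x * Cp - K * (y₁ S * y₂ S)) =
        x * (wL S * ((∑ k ∈ S, a k : ℕ) : ℝ)) - x * Cp * wL S - K * (wL S * (y₁ S * y₂ S)) := fun S _ => by ring
    rw [Finset.sum_congr rfl e, Finset.sum_sub_distrib, Finset.sum_sub_distrib, ← Finset.mul_sum, ← Finset.mul_sum,
      ← Finset.mul_sum, hA, hC, hW, mul_one]
  rw [e1] at hsum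
  have hm0 : wL ∅ = ∏ k ∈ L, (1 - p k) := Finset.prod_congr rfl fun k _ => by rw [if_neg (Finset.notMem_empty k)]
  rw [hm0] at hsum
  -- `K m₁ m₂ ≤ x²(xM − Cp)` and the credit close the estimate
  have hKm : K * (m₁ * m₂) ≤ x ^ 2 * (x * (B₁ + B₂) - Cp) := by
    have h1 : m₁ * m₂ ≤ (x * B₁) * (x * B₂) := mul_le_mul hm1le hm2le hm2nn (by nlinarith)
    calc K * (m₁ * m₂) ≤ K * ((x * B₁) * (x * B₂)) := mul_le_mul_of_nonneg_left h1 hK0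
      _ = x ^ 2 * (K * (B₁ * B₂)) := by ring
      _ = x ^ 2 * (x * (B₁ + B₂) - Cp) := by rw [hKB]
  nlinarith [hsum, hKm, hCL, mul_pos hx0 h1x]

/-- **CONJECTURE DIB\* FOR TWO-BIN MEDIUM CLOUDS** (DIB\*'s binder shape): floor `0 < x < 1`, gates in `[0,1]`; the lights
(`g k < x`) each of size `> Cp/2` and split by a finset `P` into two bins of size `≤ Cp/x` (`Cp = 2j − Σ_{x ≤ g} a·g`); the DIB\* credit
⟹ `x ≤ P(Σ_{open} a ≥ j+1)`.  One light per bin is `dibStar_of_twoMediumLights`. [this work] -/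
theorem dibStar_of_twoBins [Fintype κ] (x : ℝ) (hx0 : 0 < x) (hx1 : x < 1) (a : κ → ℕ) (g : κ → ℝ) (j : ℕ)
    (hg : ∀ k, 0 ≤ g k ∧ g k ≤ 1) (P : Finset κ)
    (hmid : ∀ k, g k < x → (2 * j : ℝ) < (∑ i ∈ Finset.univ.filter (fun i => x ≤ g i), (a i : ℝ) * g i) + 2 * (a k : ℝ))
    (hbin₁ : (∑ i ∈ Finset.univ.filter (fun i => x ≤ g i), (a i : ℝ) * g i) +
      x * (∑ k ∈ (Finset.univ.filter (fun k => g k < x)) ∩ P, (a k : ℝ)) ≤ 2 * j)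
    (hbin₂ : (∑ i ∈ Finset.univ.filter (fun i => x ≤ g i), (a i : ℝ) * g i) +
      x * (∑ k ∈ (Finset.univ.filter (fun k => g k < x)) \ P, (a k : ℝ)) ≤ 2 * j)
    (hcredit : (2 * j : ℝ) < ∑ k, (a k : ℝ) * (if x ≤ g k then g k else (g k - x ^ 2) / (1 - x))) :
    x ≤ ∑ W : Finset κ, (∏ k, if k ∈ W then g k else 1 - g k) * (if j + 1 ≤ ∑ k ∈ W, a k then (1 : ℝ) else 0) := by
  set L : Finset κ := Finset.univ.filter (fun k => g k < x) with hL
  have hmemL : ∀ k, k ∈ L ↔ g k < x := fun k => by simp [hL]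
  have hUeq : Finset.univ \ L = Finset.univ.filter (fun i => x ≤ g i) := by
    ext i; simp [hL, not_lt]
  have hsplit : ∑ k, (a k : ℝ) * (if x ≤ g k then g k else (g k - x ^ 2) / (1 - x)) =
      (∑ k ∈ Finset.univ \ L, (a k : ℝ) * g k) + ∑ k ∈ L, (a k : ℝ) * ((g k - x ^ 2) / (1 - x)) := by
    rw [← Finset.sum_sdiff (Finset.subset_univ L)]
    congr 1
    · refine Finset.sum_congr rfl fun k hk => ?_
      have hkL : k ∉ L := (Finset.mem_sdiff.1 hk).2
      rw [if_pos (not_lt.1 fun h => hkL ((hmemL k).2 h))]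
    · refine Finset.sum_congr rfl fun k hk => ?_
      rw [if_neg (not_le.2 ((hmemL k).1 hk))]
  rw [hsplit] at hcredit
  rw [← hUeq] at hmid hbin₁ hbin₂
  refine tail_ge_of_twoBins g a x hx0 hx1 (fun k => (hg k).1) (fun k => (hg k).2) L
    (fun k hk => not_lt.1 fun h => hk ((hmemL k).2 h)) (fun k hk => (hmemL k).1 hk) j
    (fun k hk => hmid k ((hmemL k).1 hk)) (L ∩ P) (L \ P) (by rw [Finset.union_comm]; exact Finset.sdiff_union_inter L P) (Finset.disjoint_sdiff_inter L P).symm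
    hbin₁ hbin₂ hcredit

end IndepBlob

end Quant

end Summit.CriticalPhenomena.PercolationContinuityZ3.Theorems
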